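import Summits.QuantumFields.BalabanUV.Beta.FP.StepLawAssembly
import Summits.QuantumFields.BalabanUV.Beta.FP.RoadFromSlots
import Summits.QuantumFields.BalabanUV.Beta.FP.StepDefectInherit
import Literature.MathematicalPhysics.QuantumFieldTheory.Balaban1983to89.Beta.StepDriftWitness

/-!
# `BalabanUV.Beta.FP.StepLawInherit` — road «FP» for binder row D1, the READ-OUT-LEVEL twin of the owner's N2-inherit socket
# `FP/StepDefectInherit` (p218992): THE PERFECT STEP LAW IS INHERITED FROM THE FINITE-LEVEL STEP IDENTITIES READ OUT — level-wise additivity of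
# the (1.22) read-outs with an (asymptotically) invisible defect + convergence of the READ-OUTS ONLY ⟹ `fPerf (m+1) = fPerf m + fPerf 1` (= the ENDs'
# binder `hstep`), the two road ENDs with `hstep` so replaced, and the END-of-record's N2 binders for the explicit defect shown to carry exactly that content

HONEST DEPENDENCY (page 1, mandatory): continuum YM on T⁴ ⇐ BetaPertH ∧ nine spine estimates (0/9 proved); BetaPertH ⇐ (D1) ∧ (D4) ∧ CAP+tail;
G-an2-4 gates asym, D1 and NE2/3/4.  HONEST FRAMING (cell contract, verbatim): «discharging `BetaPertH` makes Bałaban's UV stability UNCONDITIONAL — a real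
constructive-QFT result; it is NOT the continuum limit and NOT the Clay problem.»  THIS MODULE DISCHARGES NOTHING: it is inheritance PLUMBING next to the
owner d1-p3's N2-inherit socket of record `FP/StepDefectInherit.stepDefect_inherit` (`HOME/b2b-balaban-beta-d1-p3/OWNER-RULINGS-FP-1.md` R-FP-5: «all content is
`hSDF` = β-additivity of the perfect polarizations, INHERITED from the composed road's P6 layer»).  Every finite-level identity, every vanishing of a defect
read-out, every convergence is a HYPOTHESIS displayed in the signature; nothing of Bałaban's operators is used; no `def`, no `Prop` mirror, no cited fact,
0 sorry; 0 wall binders; NOT N2 content, NOT `hstep` proved, NOT D1, NOT BetaPertH, NOT continuum, NOT Clay.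

ABSOLUTE RULE (cell charter, verbatim): «No internally-minted statement may enter as a cited fact. Every hypothesis is either kernel-proved in this package or a
verbatim quotation of a PUBLISHED theorem with page reference. The manuscript(s) under audit are NOT citable for their own disputed steps — they are the thing under
adjudication; programme-internal (2001/route/tribunal) claims are never citable.»

WHY, AND WHAT IS DIFFERENT FROM `StepDefectInherit`.  The owner's socket works at KERNEL level: finite-level identities `Tj j (m+1) = Rj j m + Tj j m + Dj j m`,
ENTRYWISE convergence of the kernels `Tj`, `Rj` and a level-uniform (5.10) majorant OF THE DEFECTS give `(hfub, hDA, hSDF)` for `defect TP RP` by Tannery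
(`StepDefectInherit.tendsto_secondMoment_of_decay510`).  The ENDs, however, consume only the STEP LAW of the READ-OUTS (`PerfectObjectsT.d1Drift_JsBalOf_of_perfect_step_law_bounded`'s
`hstep`; `StepLawAssembly.secondMoment_succ_of_fubini` turns the N2 triple into it), and at finite base level the step identity is already available READ OUT —
the shape of the lead's `StepDriftWitness.secondMoment_step_sd` («`secondMoment (𝒯 (j+1)) = secondMoment (𝒯 j) + secondMoment (T j) + secondMoment (SD j)`», the
transported term read off EXACTLY by an4's `d = 4` marginality) with the (SDF) clause `StepDriftWitness.SDInvisible`.  So the step law passes to the limit in the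
base level from the convergence of the READ-OUTS ALONE (real sequences; §1) — no entrywise convergence of the transported kernels, no majorant of the defects, and
the defect read-out may be merely ASYMPTOTICALLY invisible (`e j m → 0`).  §2 supplies that weakest form of (inv) from the owner's Tannery lemma.  §3 instantiates
§1 at the perfect family: LITERALLY `hstep`, and the two road ENDs (`PerfectObjectsT` rate currency, `RoadFromSlots` slot currency = the END of record's) with
`hstep` replaced by the level-wise read-out data.  §4 is R-FP-5's literal reading for the END of record (`StepLawKHolds.d1Drift_JsBalOf_of_rows_bounded` still takes
the triple): for `D := StepDefectInherit.defect TP RP` with `RP m` the EXPLICIT transported first step `(N m)^8·dressedEntry (w m) (TP 1) ((N m)•·)`, `hDA` follows from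
`AbsMoment₂` of the `TP m` and of the weights alone («hDA by `absMoment₂_TPerfOf` ×3»: `StepDriftWitness.absMoment₂_dressedEntry/_comp_zsmul/_add_gen/_sub_gen`,
`HessianTelescopingKKT.absMoment₂_const_mul'` — no defect majorant) and `hSDF` ⟸ the READ-OUT STEP LAW + admissibility (`StepLawAssembly.m2Tensor_succ_of_fubini` run
backwards) — so the END-of-record's N2 binders carry EXACTLY the content «step law of the perfect read-outs», which §1–§3 inherit from the finite levels.

NOT HERE: the identification of the level-`j` read-outs with `TshotOf` of shifted jet data / with `TPerfOf` over leaf-08's decimated composites ((R1), REBASE-J —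
an2/an4/lead), the X1m-S/W suppliers of (conv) for `m ≥ 2`, PIN-R1∞-β, N7; the kernel-level socket (owner's `StepDefectInherit`).
-/

namespace Summit.QuantumFields.BalabanUV.Beta.FP.StepLawInherit

open Filter Topology
open Literature.MathematicalPhysics.QuantumFieldTheory.Balaban1983to89
open Literature.MathematicalPhysics.QuantumFieldTheory.Balaban1983to89.Beta
open B12Beta (secondMoment)
open B12Sec2to5 (Decay510)
open DecimatedMomentSummable (AbsMoment₂)
open DressedMomentNormalisation (EKer m2Tensor dressedEntry EntryHyps)
open ExpKernelCalculus (MKer Decays VertexFamily₂)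
open OneStepResolventKernel (Fib LocStencil)
open OneStepKernelFamily (KInvStep D1Drift)
open BalabanStepJetsSucc (JsBal0Of JsBalOf)
open B12Normalization (stepBal)
open StepDriftWitness (absMoment₂_sub_gen absMoment₂_add_gen absMoment₂_dressedEntry absMoment₂_comp_zsmul)
open HessianTelescopingKKT (absMoment₂_const_mul')
open Summit.QuantumFields.BalabanUV.Beta.HessKerDressedUnits (unitK unitS unitW)
open Summit.QuantumFields.BalabanUV.Beta.FP.PerfectObjectsT (KPerf SPerfOf WPerfOf TPerfOf fPerf d1Drift_JsBalOf_of_perfect_step_law_bounded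
  d1Drift_JsBalOf_of_perfect_step_law_littleO)
open Summit.QuantumFields.BalabanUV.Beta.FP.StepLawAssembly (m2Tensor_succ_of_fubini secondMoment_eq_m2Tensor)
open Summit.QuantumFields.BalabanUV.Beta.FP.RoadFromSlots (d1Drift_JsBalOf_of_slots_step_law_bounded d1Drift_JsBalOf_of_slots_step_law_littleO)
open Summit.QuantumFields.BalabanUV.Beta.GAN24.CombesThomas (sfStep smStep)
open Summit.QuantumFields.BalabanUV.Beta.FP.StepDefectInherit (defect fubini_defect tendsto_secondMoment_of_decay510)

/-! ## §1 The step law of the limit read-outs from level-wise additivity (real sequences) -/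

section Reals

/-- [our object] **THE PERFECT STEP LAW FROM LEVEL-WISE ADDITIVITY, LAST-STEP-OUT.**  Level-indexed read-outs `Sr j m` (base level `j`, `m` steps), defect
read-outs `e j m` and limit read-outs `F m` with: (add) `Sr j (m+1) = Sr j m + Sr (j+m) 1 + e j m` for all `j` and `m ≥ 1` (the last step is taken at level
`j + m`); (inv) `e j m → 0` as `j → ∞` (asymptotic invisibility; (SDF)_j `e j m = 0` is the special case); (conv) `Sr j m → F m` for every `m ≥ 1`.
THEN `F (m+1) = F m + F 1` for every `m ≥ 1` — the `m = 1` leg at level `j + m` is a shifted subsequence of the `m = 1` convergence. -/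
theorem stepLaw_of_levelwise {Sr e : ℕ → ℕ → ℝ} {F : ℕ → ℝ}
    (hadd : ∀ j m : ℕ, 1 ≤ m → Sr j (m + 1) = Sr j m + Sr (j + m) 1 + e j m)
    (he : ∀ m : ℕ, 1 ≤ m → Tendsto (fun j => e j m) atTop (𝓝 0))
    (hconv : ∀ m : ℕ, 1 ≤ m → Tendsto (fun j => Sr j m) atTop (𝓝 (F m))) :
    ∀ m : ℕ, 1 ≤ m → F (m + 1) = F m + F 1 := by
  intro m hm
  have h1 : Tendsto (fun j => Sr (j + m) 1) atTop (𝓝 (F 1)) := (hconv 1 le_rfl).comp (tendsto_add_atTop_nat m)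
  have h2 : Tendsto (fun j => Sr j m + Sr (j + m) 1 + e j m) atTop (𝓝 (F m + F 1 + 0)) := ((hconv m hm).add h1).add (he m hm)
  have h3 : Tendsto (fun j => Sr j (m + 1)) atTop (𝓝 (F m + F 1 + 0)) := h2.congr fun j => (hadd j m hm).symm
  have h4 := tendsto_nhds_unique (hconv (m + 1) (by omega)) h3
  rw [h4, add_zero]

/-- [our object] The (SDF)_j form: exact invisibility `e j m = 0` at every level. -/
theorem stepLaw_of_levelwise_exact {Sr : ℕ → ℕ → ℝ} {F : ℕ → ℝ}
    (hadd : ∀ j m : ℕ, 1 ≤ m → Sr j (m + 1) = Sr j m + Sr (j + m) 1)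
    (hconv : ∀ m : ℕ, 1 ≤ m → Tendsto (fun j => Sr j m) atTop (𝓝 (F m))) :
    ∀ m : ℕ, 1 ≤ m → F (m + 1) = F m + F 1 :=
  stepLaw_of_levelwise (e := fun _ _ => 0) (fun j m hm => by rw [hadd j m hm, add_zero]) (fun _ _ => tendsto_const_nhds) hconv

/-- [our object] **FIRST-STEP-OUT TWIN**: (add′) `Sr j (m+1) = Sr j 1 + Sr (j+1) m + e j m` (the first step at level `j`, the remaining `m` steps from level
`j + 1`) with the same (inv)/(conv) ⟹ `F (m+1) = F m + F 1`. -/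
theorem stepLaw_of_levelwise_first {Sr e : ℕ → ℕ → ℝ} {F : ℕ → ℝ}
    (hadd : ∀ j m : ℕ, 1 ≤ m → Sr j (m + 1) = Sr j 1 + Sr (j + 1) m + e j m)
    (he : ∀ m : ℕ, 1 ≤ m → Tendsto (fun j => e j m) atTop (𝓝 0))
    (hconv : ∀ m : ℕ, 1 ≤ m → Tendsto (fun j => Sr j m) atTop (𝓝 (F m))) :
    ∀ m : ℕ, 1 ≤ m → F (m + 1) = F m + F 1 := by
  intro m hm
  have h1 : Tendsto (fun j => Sr (j + 1) m) atTop (𝓝 (F m)) := (hconv m hm).comp (tendsto_add_atTop_nat 1)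
  have h2 : Tendsto (fun j => Sr j 1 + Sr (j + 1) m + e j m) atTop (𝓝 (F 1 + F m + 0)) := ((hconv 1 le_rfl).add h1).add (he m hm)
  have h3 : Tendsto (fun j => Sr j (m + 1)) atTop (𝓝 (F 1 + F m + 0)) := h2.congr fun j => (hadd j m hm).symm
  have h4 := tendsto_nhds_unique (hconv (m + 1) (by omega)) h3
  rw [h4, add_zero, add_comm]

/-- [our object] **KERNEL READ-OUT FORM** of `stepLaw_of_levelwise`: level-indexed kernels `T j m` (READING: the one-loop polarization of the `m`-step composite
from base level `j`, rescaled — e.g. `TshotOf` of the jet data shifted by `j`), defect kernels `D j m` with the (SDF)_j clause `secondMoment (D j m) μ ν = 0`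
(`StepDriftWitness.SDInvisible` shape), the level-wise step identity READ OUT (`StepDriftWitness.secondMoment_step_sd` shape) and convergence of the read-outs
to those of limit kernels `Tinf m` ⟹ the step law of the limit read-outs. -/
theorem secondMoment_stepLaw_of_levelwise {T D : ℕ → ℕ → EKer 4} {Tinf : ℕ → EKer 4} (μ ν : Fin 4)
    (hadd : ∀ j m : ℕ, 1 ≤ m → secondMoment (T j (m + 1)) μ ν
      = secondMoment (T j m) μ ν + secondMoment (T (j + m) 1) μ ν + secondMoment (D j m) μ ν)
    (hSDF : ∀ j m : ℕ, 1 ≤ m → secondMoment (D j m) μ ν = 0)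
    (hconv : ∀ m : ℕ, 1 ≤ m → Tendsto (fun j => secondMoment (T j m) μ ν) atTop (𝓝 (secondMoment (Tinf m) μ ν))) :
    ∀ m : ℕ, 1 ≤ m → secondMoment (Tinf (m + 1)) μ ν = secondMoment (Tinf m) μ ν + secondMoment (Tinf 1) μ ν :=
  stepLaw_of_levelwise_exact (Sr := fun j m => secondMoment (T j m) μ ν) (F := fun m => secondMoment (Tinf m) μ ν)
    (fun j m hm => by rw [hadd j m hm, hSDF j m hm, add_zero]) hconv

end Reals

/-! ## §2 The weakest supplier of (inv): asymptotic invisibility from dominated entrywise vanishing (owner's Tannery lemma BY NAME) -/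

section Tannery

variable {d : ℕ}

/-- [our object] **ASYMPTOTIC INVISIBILITY FROM DOMINATED ENTRYWISE VANISHING**: if the defect kernels' channel `(μ, ν)` tends to `0` entrywise under a
level-uniform (5.10) majorant, their read-outs tend to `0` — §1's hypothesis (inv) when (SDF)_j is not known exactly at finite level
(`StepDefectInherit.tendsto_secondMoment_of_decay510` at the zero limit kernel). -/
theorem tendsto_secondMoment_zero_of_tendsto {D : ℕ → B12Beta.Kernel d} {μ ν : Fin d} {C δ : ℝ} (hδ : 0 < δ)
    (hdec : ∀ j, Decay510 (D j μ ν) C δ) (hlim : ∀ z, Tendsto (fun j => D j μ ν z) atTop (𝓝 0)) :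
    Tendsto (fun j => secondMoment (D j) μ ν) atTop (𝓝 0) := by
  have h := tendsto_secondMoment_of_decay510 (P := D) (Pinf := fun _ _ _ => 0) hδ hdec (fun z => by simpa using hlim z)
  have h0 : secondMoment (fun _ _ _ => (0 : ℝ) : B12Beta.Kernel d) μ ν = 0 := by
    unfold B12Beta.secondMoment; simp
  rwa [h0] at h

end Tannery

/-! ## §3 The perfect family: the END's `hstep` from level-wise data, and the END with `hstep` so replaced -/

section Perfect

variable {Lc : ℕ} [NeZero Lc] (hLc : 1 ≤ Lc) (cE cVH cΛ : ℝ)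
  (W : ℕ → Fin (3 + 1) → (Fin (3 + 1) → ℤ) → Fin (3 + 1) → (Fin (3 + 1) → ℤ) → MKer (3 + 1) (Fib 3))
  (Cw' δw : ℕ → ℝ) (hδw : ∀ j, 0 < δw j) (hW' : ∀ j, VertexFamily₂ (W j) Lc (Cw' j) (δw j))
  (sf sm : ℕ → ℝ)
  (S : ℕ → ℕ → Fin (3 + 1) → (Fin (3 + 1) → ℤ) → MKer (3 + 1) (Fib 3))
  (Wt : ℕ → ℕ → Fin (3 + 1) → (Fin (3 + 1) → ℤ) → Fin (3 + 1) → (Fin (3 + 1) → ℤ) → MKer (3 + 1) (Fib 3))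
  {R C cK δK Cs cS δS Cw cW δW θ : ℝ}

/-- [our object] **THE END's `hstep` FROM LEVEL-WISE DATA.**  Level-indexed read-outs `Sr j m` with last-step-out additivity, asymptotically invisible defect
read-outs and convergence `Sr j m → fPerf … m` (`m ≥ 1`) ⟹ `∀ m ≥ 1, fPerf … (m+1) = fPerf … m + fPerf … 1` — LITERALLY the binder `hstep` of
`PerfectObjectsT.d1Drift_JsBalOf_of_perfect_step_law_bounded / _littleO` (and of `StepLawKHolds` one level up, via `StepLawAssembly`). -/
theorem fPerf_succ_of_levelwise (μ ν : Fin 4) {Sr e : ℕ → ℕ → ℝ}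
    (hadd : ∀ j m : ℕ, 1 ≤ m → Sr j (m + 1) = Sr j m + Sr (j + m) 1 + e j m)
    (he : ∀ m : ℕ, 1 ≤ m → Tendsto (fun j => e j m) atTop (𝓝 0))
    (hconv : ∀ m : ℕ, 1 ≤ m → Tendsto (fun j => Sr j m) atTop (𝓝 (fPerf Lc sf sm S Wt μ ν m))) :
    ∀ m : ℕ, 1 ≤ m → fPerf Lc sf sm S Wt μ ν (m + 1) = fPerf Lc sf sm S Wt μ ν m + fPerf Lc sf sm S Wt μ ν 1 :=
  stepLaw_of_levelwise hadd he hconv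

/-- [our object] **ROAD «FP», THE END WITH THE STEP LAW INHERITED (bounded-defect form).**  `PerfectObjectsT.d1Drift_JsBalOf_of_perfect_step_law_bounded`
with its binder `hstep` REPLACED by the level-wise data (add)/(inv)/(conv) of `fPerf_succ_of_levelwise`; every other binder (the nine (CONV-C-Cauchy) rows at
the perfect triple, the pins, `hasym`) unchanged and displayed.  Discharges nothing by itself. -/
theorem d1Drift_JsBalOf_of_levelwise_bounded (hsf : ∀ j, sf j ≠ 0) (hsm : ∀ j, sm j ≠ 0)
    (hS1 : ∀ j, S j 1 = (JsBal0Of hLc cE cVH cΛ W Cw' δw hδw hW' j).S) (hW1 : ∀ j, Wt j 1 = W j)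
    (hK : ∀ j, Decays (unitK (sf j) (sm j) (KInvStep (d := 3) Lc j)) C δK) (hKinf : Decays (KPerf (d := 3) Lc sf sm 1) C δK)
    (hKrate : ∀ j, Decays (unitK (sf j) (sm j) (KInvStep (d := 3) Lc j) - KPerf (d := 3) Lc sf sm 1) (cK * θ ^ j) δK)
    (hS : ∀ j, LocStencil (unitS (sf j) (sm j) (JsBal0Of hLc cE cVH cΛ W Cw' δw hδw hW' j).S) Cs δS) (hSinf : LocStencil (SPerfOf sf sm S 1) Cs δS)
    (hSrate : ∀ j, LocStencil (unitS (sf j) (sm j) (JsBal0Of hLc cE cVH cΛ W Cw' δw hδw hW' j).S - SPerfOf sf sm S 1) (cS * θ ^ j) δS)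
    (hW : ∀ j, VertexFamily₂ (unitW (sf j) (sm j) (W j)) Lc Cw δW) (hWinf : VertexFamily₂ (WPerfOf sf sm Wt 1) Lc Cw δW)
    (hWrate : ∀ j, VertexFamily₂ (unitW (sf j) (sm j) (W j) - WPerfOf sf sm Wt 1) Lc (cW * θ ^ j) δW)
    (hR : 0 < R) (hRK : R < δK) (hRS : R / 2 < δS) (hRW : R < δW) (hθ0 : 0 ≤ θ) (hθ1 : θ < 1) (μ ν : Fin 4) {N Cg : ℝ}
    {Sr e : ℕ → ℕ → ℝ}
    (hadd : ∀ j m : ℕ, 1 ≤ m → Sr j (m + 1) = Sr j m + Sr (j + m) 1 + e j m)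
    (he : ∀ m : ℕ, 1 ≤ m → Tendsto (fun j => e j m) atTop (𝓝 0))
    (hconv : ∀ m : ℕ, 1 ≤ m → Tendsto (fun j => Sr j m) atTop (𝓝 (fPerf Lc sf sm S Wt μ ν m)))
    (hasym : ∀ m : ℕ, 1 ≤ m → |fPerf Lc sf sm S Wt μ ν m - (m : ℝ) * stepBal N Lc| ≤ Cg) :
    D1Drift Lc (JsBalOf hLc cE cVH cΛ W Cw' δw hδw hW') N μ ν :=
  d1Drift_JsBalOf_of_perfect_step_law_bounded hLc cE cVH cΛ W Cw' δw hδw hW' sf sm S Wt hsf hsm hS1 hW1 hK hKinf hKrate hS hSinf hSrate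
    hW hWinf hWrate hR hRK hRS hRW hθ0 hθ1 μ ν (fPerf_succ_of_levelwise sf sm S Wt μ ν hadd he hconv) hasym

/-- [our object] **ROAD «FP», THE END WITH THE STEP LAW INHERITED (mean-law form).** -/
theorem d1Drift_JsBalOf_of_levelwise_littleO (hsf : ∀ j, sf j ≠ 0) (hsm : ∀ j, sm j ≠ 0)
    (hS1 : ∀ j, S j 1 = (JsBal0Of hLc cE cVH cΛ W Cw' δw hδw hW' j).S) (hW1 : ∀ j, Wt j 1 = W j)
    (hK : ∀ j, Decays (unitK (sf j) (sm j) (KInvStep (d := 3) Lc j)) C δK) (hKinf : Decays (KPerf (d := 3) Lc sf sm 1) C δK)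
    (hKrate : ∀ j, Decays (unitK (sf j) (sm j) (KInvStep (d := 3) Lc j) - KPerf (d := 3) Lc sf sm 1) (cK * θ ^ j) δK)
    (hS : ∀ j, LocStencil (unitS (sf j) (sm j) (JsBal0Of hLc cE cVH cΛ W Cw' δw hδw hW' j).S) Cs δS) (hSinf : LocStencil (SPerfOf sf sm S 1) Cs δS)
    (hSrate : ∀ j, LocStencil (unitS (sf j) (sm j) (JsBal0Of hLc cE cVH cΛ W Cw' δw hδw hW' j).S - SPerfOf sf sm S 1) (cS * θ ^ j) δS)
    (hW : ∀ j, VertexFamily₂ (unitW (sf j) (sm j) (W j)) Lc Cw δW) (hWinf : VertexFamily₂ (WPerfOf sf sm Wt 1) Lc Cw δW)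
    (hWrate : ∀ j, VertexFamily₂ (unitW (sf j) (sm j) (W j) - WPerfOf sf sm Wt 1) Lc (cW * θ ^ j) δW)
    (hR : 0 < R) (hRK : R < δK) (hRS : R / 2 < δS) (hRW : R < δW) (hθ0 : 0 ≤ θ) (hθ1 : θ < 1) (μ ν : Fin 4) {N : ℝ}
    {Sr e : ℕ → ℕ → ℝ}
    (hadd : ∀ j m : ℕ, 1 ≤ m → Sr j (m + 1) = Sr j m + Sr (j + m) 1 + e j m)
    (he : ∀ m : ℕ, 1 ≤ m → Tendsto (fun j => e j m) atTop (𝓝 0))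
    (hconv : ∀ m : ℕ, 1 ≤ m → Tendsto (fun j => Sr j m) atTop (𝓝 (fPerf Lc sf sm S Wt μ ν m)))
    (hasym : Tendsto (fun m : ℕ => (fPerf Lc sf sm S Wt μ ν m - (m : ℝ) * stepBal N Lc) / (m : ℝ)) atTop (𝓝 0)) :
    D1Drift Lc (JsBalOf hLc cE cVH cΛ W Cw' δw hδw hW') N μ ν :=
  d1Drift_JsBalOf_of_perfect_step_law_littleO hLc cE cVH cΛ W Cw' δw hδw hW' sf sm S Wt hsf hsm hS1 hW1 hK hKinf hKrate hS hSinf hSrate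
    hW hWinf hWrate hR hRK hRS hRW hθ0 hθ1 μ ν (fPerf_succ_of_levelwise sf sm S Wt μ ν hadd he hconv) hasym

/-- [our object] **ROAD «FP», THE END IN SLOT CURRENCY WITH THE STEP LAW INHERITED (bounded-defect form)** — the currency of the END of record:
`RoadFromSlots.d1Drift_JsBalOf_of_slots_step_law_bounded` (`d = 3`, `2 ≤ Lc`, adopted units `sfStep`/`smStep 3`, S- and W-slot Cauchy rows, `m = 1` pins)
with its binder `hstep` REPLACED by the level-wise data (add)/(inv)/(conv).  Discharges nothing by itself. -/
theorem d1Drift_JsBalOf_of_slots_levelwise_bounded {Cs cS δS θS Cw cW δW θW : ℝ} (hLc2 : 2 ≤ Lc)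
    (hS1 : ∀ j, S j 1 = (JsBal0Of hLc cE cVH cΛ W Cw' δw hδw hW' j).S) (hW1 : ∀ j, Wt j 1 = W j)
    (hS : ∀ j, LocStencil (unitS (sfStep Lc j) (smStep 3 Lc j) (JsBal0Of hLc cE cVH cΛ W Cw' δw hδw hW' j).S) Cs δS)
    (hSall : ∀ k j, LocStencil (unitS (sfStep Lc (k + j)) (smStep 3 Lc (k + j)) (JsBal0Of hLc cE cVH cΛ W Cw' δw hδw hW' (k + j)).S -
      unitS (sfStep Lc k) (smStep 3 Lc k) (JsBal0Of hLc cE cVH cΛ W Cw' δw hδw hW' k).S) (cS * θS ^ k) δS)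
    (hW : ∀ j, VertexFamily₂ (unitW (sfStep Lc j) (smStep 3 Lc j) (W j)) Lc Cw δW)
    (hWall : ∀ k j, VertexFamily₂ (unitW (sfStep Lc (k + j)) (smStep 3 Lc (k + j)) (W (k + j)) - unitW (sfStep Lc k) (smStep 3 Lc k) (W k)) Lc
      (cW * θW ^ k) δW)
    (hδS : 0 < δS) (hδW : 0 < δW) (hθS0 : 0 ≤ θS) (hθS1 : θS < 1) (hθW0 : 0 ≤ θW) (hθW1 : θW < 1) (μ ν : Fin 4) {N Cg : ℝ}
    {Sr e : ℕ → ℕ → ℝ}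
    (hadd : ∀ j m : ℕ, 1 ≤ m → Sr j (m + 1) = Sr j m + Sr (j + m) 1 + e j m)
    (he : ∀ m : ℕ, 1 ≤ m → Tendsto (fun j => e j m) atTop (𝓝 0))
    (hconv : ∀ m : ℕ, 1 ≤ m → Tendsto (fun j => Sr j m) atTop (𝓝 (fPerf Lc (sfStep Lc) (smStep 3 Lc) S Wt μ ν m)))
    (hasym : ∀ m : ℕ, 1 ≤ m → |fPerf Lc (sfStep Lc) (smStep 3 Lc) S Wt μ ν m - (m : ℝ) * stepBal N Lc| ≤ Cg) :
    D1Drift Lc (JsBalOf hLc cE cVH cΛ W Cw' δw hδw hW') N μ ν :=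
  d1Drift_JsBalOf_of_slots_step_law_bounded hLc cE cVH cΛ W Cw' δw hδw hW' S Wt hLc2 hS1 hW1 hS hSall hW hWall hδS hδW hθS0 hθS1 hθW0 hθW1
    μ ν (fPerf_succ_of_levelwise (sfStep Lc) (smStep 3 Lc) S Wt μ ν hadd he hconv) hasym

/-- [our object] **ROAD «FP», THE END IN SLOT CURRENCY WITH THE STEP LAW INHERITED (mean-law form)**: `RoadFromSlots.d1Drift_JsBalOf_of_slots_step_law_littleO`
with `hstep` REPLACED by the level-wise data.  Discharges nothing by itself. -/
theorem d1Drift_JsBalOf_of_slots_levelwise_littleO {Cs cS δS θS Cw cW δW θW : ℝ} (hLc2 : 2 ≤ Lc)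
    (hS1 : ∀ j, S j 1 = (JsBal0Of hLc cE cVH cΛ W Cw' δw hδw hW' j).S) (hW1 : ∀ j, Wt j 1 = W j)
    (hS : ∀ j, LocStencil (unitS (sfStep Lc j) (smStep 3 Lc j) (JsBal0Of hLc cE cVH cΛ W Cw' δw hδw hW' j).S) Cs δS)
    (hSall : ∀ k j, LocStencil (unitS (sfStep Lc (k + j)) (smStep 3 Lc (k + j)) (JsBal0Of hLc cE cVH cΛ W Cw' δw hδw hW' (k + j)).S -
      unitS (sfStep Lc k) (smStep 3 Lc k) (JsBal0Of hLc cE cVH cΛ W Cw' δw hδw hW' k).S) (cS * θS ^ k) δS)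
    (hW : ∀ j, VertexFamily₂ (unitW (sfStep Lc j) (smStep 3 Lc j) (W j)) Lc Cw δW)
    (hWall : ∀ k j, VertexFamily₂ (unitW (sfStep Lc (k + j)) (smStep 3 Lc (k + j)) (W (k + j)) - unitW (sfStep Lc k) (smStep 3 Lc k) (W k)) Lc
      (cW * θW ^ k) δW)
    (hδS : 0 < δS) (hδW : 0 < δW) (hθS0 : 0 ≤ θS) (hθS1 : θS < 1) (hθW0 : 0 ≤ θW) (hθW1 : θW < 1) (μ ν : Fin 4) {N : ℝ}
    {Sr e : ℕ → ℕ → ℝ}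
    (hadd : ∀ j m : ℕ, 1 ≤ m → Sr j (m + 1) = Sr j m + Sr (j + m) 1 + e j m)
    (he : ∀ m : ℕ, 1 ≤ m → Tendsto (fun j => e j m) atTop (𝓝 0))
    (hconv : ∀ m : ℕ, 1 ≤ m → Tendsto (fun j => Sr j m) atTop (𝓝 (fPerf Lc (sfStep Lc) (smStep 3 Lc) S Wt μ ν m)))
    (hasym : Tendsto (fun m : ℕ => (fPerf Lc (sfStep Lc) (smStep 3 Lc) S Wt μ ν m - (m : ℝ) * stepBal N Lc) / (m : ℝ)) atTop (𝓝 0)) :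
    D1Drift Lc (JsBalOf hLc cE cVH cΛ W Cw' δw hδw hW') N μ ν :=
  d1Drift_JsBalOf_of_slots_step_law_littleO hLc cE cVH cΛ W Cw' δw hδw hW' S Wt hLc2 hS1 hW1 hS hSall hW hWall hδS hδW hθS0 hθS1 hθW0 hθW1
    μ ν (fPerf_succ_of_levelwise (sfStep Lc) (smStep 3 Lc) S Wt μ ν hadd he hconv) hasym

end Perfect

/-! ## §4 R-FP-5 literal, for the END of record: the N2 binders of the explicit defect carry exactly the read-out step law -/

section Binders

variable {TP w : ℕ → EKer 4} {N : ℕ → ℕ}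

/-- [our object] **`hDA` FOR THE EXPLICIT DEFECT from `AbsMoment₂` of the perfect kernels and of the weights** (no defect majorant): with the transported
first step `RP m := (N m)^8·dressedEntry (w m) (TP 1) ((N m)•·)` and `D := StepDefectInherit.defect TP RP`, the transported term has an absolutely summable second
moment because the two-sided dressed kernel of three such patterns does (`StepDriftWitness.absMoment₂_dressedEntry`) and decimation `z ↦ N•z` preserves it
(`absMoment₂_comp_zsmul`); then closure under `r·` and `−`. -/
theorem absMoment₂_defect_explicit (hN : ∀ m : ℕ, 1 ≤ m → N m ≠ 0) (hw : ∀ m : ℕ, 1 ≤ m → ∀ κ l : Fin 4, AbsMoment₂ (w m κ l))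
    (hA : ∀ m : ℕ, 1 ≤ m → ∀ a b : Fin 4, AbsMoment₂ (TP m a b)) :
    ∀ m : ℕ, 1 ≤ m → ∀ a b : Fin 4, AbsMoment₂ (defect TP
      (fun m a b z => ((N m : ℕ) : ℝ) ^ 8 * dressedEntry (w m) (TP 1) (((N m : ℕ) : ℤ) • z) a b) m a b) := by
  intro m hm a b
  have hm1 : 1 ≤ m + 1 := Nat.le_add_left 1 m
  have h1 : AbsMoment₂ (fun y : Fin 4 → ℤ => dressedEntry (w m) (TP 1) y a b) := absMoment₂_dressedEntry (hw m hm) (hA 1 le_rfl) a b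
  have h2 := absMoment₂_comp_zsmul (hN m hm) h1
  have h3 := absMoment₂_const_mul' h2 (((N m : ℕ) : ℝ) ^ 8)
  have h4 := absMoment₂_sub_gen (hA (m + 1) hm1 a b) h3
  have h5 := absMoment₂_sub_gen h4 (hA m hm a b)
  exact h5

/-- [our object] **`hSDF` FOR THE EXPLICIT DEFECT ⟸ THE READ-OUT STEP LAW** (given admissibility of the `m`-step transport against `TP 1` and `AbsMoment₂` of the
`TP m`): `StepLawAssembly.m2Tensor_succ_of_fubini` run backwards — the transported term reads off `m2Tensor (TP 1)` exactly (an4's `d = 4` marginality), so the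
defect's read-out is `secondMoment (TP (m+1)) − secondMoment (TP 1) − secondMoment (TP m) = 0`. -/
theorem secondMoment_defect_explicit_eq_zero (hadm : ∀ m : ℕ, 1 ≤ m → EntryHyps (N m) (w m) (TP 1))
    (hA : ∀ m : ℕ, 1 ≤ m → ∀ a b : Fin 4, AbsMoment₂ (TP m a b)) (μ ν : Fin 4)
    (hstep : ∀ m : ℕ, 1 ≤ m → secondMoment (TP (m + 1)) μ ν = secondMoment (TP m) μ ν + secondMoment (TP 1) μ ν) :
    ∀ m : ℕ, 1 ≤ m → secondMoment (defect TP
      (fun m a b z => ((N m : ℕ) : ℝ) ^ 8 * dressedEntry (w m) (TP 1) (((N m : ℕ) : ℤ) • z) a b) m) μ ν = 0 := by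
  intro m hm
  have hDA := absMoment₂_defect_explicit (TP := TP) (w := w) (N := N) (fun m hm => (hadm m hm).pos.ne') (fun m hm => (hadm m hm).absW) hA
  have hfub : ∀ m : ℕ, 1 ≤ m → ∀ (a b : Fin 4) (z : Fin 4 → ℤ),
      TP (m + 1) a b z = ((N m : ℕ) : ℝ) ^ 8 * dressedEntry (w m) (TP 1) (((N m : ℕ) : ℤ) • z) a b + TP m a b z
        + defect TP (fun m a b z => ((N m : ℕ) : ℝ) ^ 8 * dressedEntry (w m) (TP 1) (((N m : ℕ) : ℤ) • z) a b) m a b z :=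
    fun m _ a b z => fubini_defect (TP := TP)
      (RP := fun m a b z => ((N m : ℕ) : ℝ) ^ 8 * dressedEntry (w m) (TP 1) (((N m : ℕ) : ℤ) • z) a b) m a b z
  have h := m2Tensor_succ_of_fubini (TP := TP) (w := w) (N := N)
    (D := defect TP (fun m a b z => ((N m : ℕ) : ℝ) ^ 8 * dressedEntry (w m) (TP 1) (((N m : ℕ) : ℤ) • z) a b))
    hfub hadm hA hDA m hm
  have h' := congrFun (congrFun (congrFun (congrFun h μ) ν) μ) ν
  simp only [Pi.add_apply] at h'
  rw [← secondMoment_eq_m2Tensor, ← secondMoment_eq_m2Tensor, ← secondMoment_eq_m2Tensor, ← secondMoment_eq_m2Tensor, hstep m hm] at h'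
  linarith

/-- [our object] **THE THREE N2 BINDERS OF THE END OF RECORD AT ONCE** (R-FP-5, literal; complementary hypotheses to `StepDefectInherit.stepDefect_inherit`):
for `D := defect TP RP` with the explicit transport `RP`, `hfub ∧ hDA ∧ hSDF` ⟸ admissibility + `AbsMoment₂ (TP m)` + the READ-OUT step law — no entrywise
convergence, no defect majorant.  I.e. the N2 binders of `StepLawAssembly.fPerf_succ_of_fubini` / `StepLawKHolds.d1Drift_JsBalOf_of_rows_bounded` carry exactly
the content «step law of the perfect read-outs», which §1–§3 inherit from the finite levels. -/
theorem n2Binders_of_stepLaw (hadm : ∀ m : ℕ, 1 ≤ m → EntryHyps (N m) (w m) (TP 1))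
    (hA : ∀ m : ℕ, 1 ≤ m → ∀ a b : Fin 4, AbsMoment₂ (TP m a b)) (μ ν : Fin 4)
    (hstep : ∀ m : ℕ, 1 ≤ m → secondMoment (TP (m + 1)) μ ν = secondMoment (TP m) μ ν + secondMoment (TP 1) μ ν) :
    (∀ m : ℕ, 1 ≤ m → ∀ (a b : Fin 4) (z : Fin 4 → ℤ),
        TP (m + 1) a b z = ((N m : ℕ) : ℝ) ^ 8 * dressedEntry (w m) (TP 1) (((N m : ℕ) : ℤ) • z) a b + TP m a b z
          + defect TP (fun m a b z => ((N m : ℕ) : ℝ) ^ 8 * dressedEntry (w m) (TP 1) (((N m : ℕ) : ℤ) • z) a b) m a b z)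
    ∧ (∀ m : ℕ, 1 ≤ m → ∀ a b : Fin 4, AbsMoment₂ (defect TP
        (fun m a b z => ((N m : ℕ) : ℝ) ^ 8 * dressedEntry (w m) (TP 1) (((N m : ℕ) : ℤ) • z) a b) m a b))
    ∧ (∀ m : ℕ, 1 ≤ m → secondMoment (defect TP
        (fun m a b z => ((N m : ℕ) : ℝ) ^ 8 * dressedEntry (w m) (TP 1) (((N m : ℕ) : ℤ) • z) a b) m) μ ν = 0) :=
  ⟨fun m _ a b z => fubini_defect (TP := TP)
      (RP := fun m a b z => ((N m : ℕ) : ℝ) ^ 8 * dressedEntry (w m) (TP 1) (((N m : ℕ) : ℤ) • z) a b) m a b z,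
    absMoment₂_defect_explicit (fun m hm => (hadm m hm).pos.ne') (fun m hm => (hadm m hm).absW) hA,
    secondMoment_defect_explicit_eq_zero hadm hA μ ν hstep⟩

end Binders

end Summit.QuantumFields.BalabanUV.Beta.FP.StepLawInherit
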